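import Summits.ResolutionOfSingularities.ResolutionOfSingularities.Theorems.PurelyInseparableDim4WideNonDrop
import Summits.ResolutionOfSingularities.ResolutionOfSingularities.Theorems.PurelyInseparableDim4WideRiseData
import HarnessLib
import HarnessLib.Audit.Tags

/-!
# A WIDE isolated edge on which `μ⁺` RISES (`6 → 7`) — ‖ K (cell `res-dim4-pi`, seat p-7 g2, brick (ι*) second row;
# specimen = res-dim4-crit-1 V-A-27 / T-A-08 «NT-RISE (u,v)³»)

[OURS · counted 0 · a negative fact about CANDIDATE monotonicity of a cell letter, certified in the kernel.]
Nothing here is a statement about resolution of singularities; resolution in dimension ≥ 4 /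
characteristic `p` is NOT proved or disproved by anything in this file.

Sequel of `PurelyInseparableDim4WideNonDrop` (`μ⁺` EQUAL on a wide edge).  Here, over `𝔽₃`
(`x, y, u, v = x₀, x₁, x₂, x₃`):

  `P = 2xy² + 2xyuv + 2v⁵ + 2x²u³ + 2x²y²v³`  —(chart `u`, origin)→  `C = 2xy² + 2xyuv + 2u²v⁵ + 2x²u² + 2x²y²u⁴v³`,

`P` an isolated wide floor state (`ord₀ = 3`, `ē = 2`, certificate level `3`, `μ⁺(P) = 6`: fat point
`K[u,v]/(u,v)³`-shaped, standard monomials `1, v, u, v², uv, u²`), `C` isolated (level `5`) with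
**`μ⁺(C) = 7`** (standard monomials `1, v, u, v², uv, v³, v⁴`).  So on wide isolated edges the
Hasse–Jacobian colength is NOT EVEN NON-INCREASING:

* **`not_wideNonIncrease_three`** — the statement «`μ⁺(s⁺) ≤ μ⁺(s)` (at certificate levels) along every
  isolated `Step0 3` edge from a floor state with `ē = 2`» is FALSE;
* `exists_wide_edge_jetColength_lt` — the exact rows `μ⁺(P) = 6 < 7 = μ⁺(C)` ‖ K.

Ingredients as in the sequel's parent file (p-13 `StepKit.step0_of`, p-8 g2 `ColengthCert`, this seat's
`ColengthLower`, p-1 g2 `NarrowApolarity`, tree `Directrix.finrank_additiveSubspace_initialForm_le_two`);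
certificate data in `PurelyInseparableDim4WideRiseData` (this seat's `𝔽₃` elimination `kb/f3cert.py`, an
independent implementation agreeing with crit-1's `w27.py`: 6 → 7), checked by `decide +kernel`.
bears_on: LADDER-RESOLUTION:D157-DOOR2 (res-dim4-pi · wide core · μ⁺ rows ‖ K · T-A-08).
Supports stmt-ResolutionOfSingularities-16155 (helper).
-/

set_option linter.dupNamespace false -- mandated namespace of this single-conjunct summit

noncomputable section

open MvPolynomial Finset

namespace Summit.ResolutionOfSingularities.ResolutionOfSingularities.Theorems.PIDim4

namespace WideRise

open StepKit ScopeCover ColengthCert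
open Literature.AlgebraicGeometry.Resolution
open Literature.AlgebraicGeometry.Resolution.Hauser2010
open Literature.AlgebraicGeometry.Resolution.HauserPerlega2019
open Literature.Barriers.ResolutionOfSingularities
open PointBlowup (additiveSubspace)

/-! ## §1 The presented states, the edge, isolation, the colength rows -/

/-- `P` presented (no boundary). [folklore] -/
def sP : SData 4 (ZMod 3) := ⟨LP, ![0, 0, 0, 0], ∅⟩

/-- `C` presented (boundary `{u = 0}` of multiplicity `0`). [folklore] -/
def sC : SData 4 (ZMod 3) := ⟨LC, ![0, 0, 0, 0], {2}⟩

/-- The edge `P → C`: point blow-up, chart `u = x₂`, origin. [folklore] -/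
theorem step_PC : Step0 3 sP.toState sC.toState :=
  step0_of 2 0 (by decide) rfl (by decide) (by decide) (by decide)

/-- `P` is an isolated `3`-fold point (certificate level `3`). [folklore] -/
theorem isIsolated_parent : IsIsolated 3 sP.toState.F :=
  isIsolated_of_isoCertB (N := 3) (cert := RP) (by decide +kernel)

/-- `C` is an isolated `3`-fold point (certificate level `5`). [folklore] -/
theorem isIsolated_child : IsIsolated 3 sC.toState.F :=
  isIsolated_of_isoCertB (N := 5) (cert := RC) (by decide +kernel)

/-- `IsCert 3 3 P`. [folklore] -/
theorem isCert_parent : RidgeBudget.IsCert 3 3 sP.toState.F := isCert_of_isoCertB (cert := RP) (by decide +kernel)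

/-- `IsCert 3 5 C`. [folklore] -/
theorem isCert_child : RidgeBudget.IsCert 3 5 sC.toState.F := isCert_of_isoCertB (cert := RC) (by decide +kernel)

/-- `μ⁺(P) ≤ 6`. [folklore] -/
theorem jetColength_parent_le : RidgeBudget.jetColength 3 3 sP.toState.F ≤ 6 :=
  jetColength_le_of_colengthCertB (B := BP) (cert := SP) (by decide +kernel)

/-- `6 ≤ μ⁺(P)`. [folklore] -/
theorem le_jetColength_parent : 6 ≤ RidgeBudget.jetColength 3 3 sP.toState.F :=
  length_le_jetColength_of_dualCertB (D := DP) (by decide +kernel)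

/-- `μ⁺(C) ≤ 7`. [folklore] -/
theorem jetColength_child_le : RidgeBudget.jetColength 3 5 sC.toState.F ≤ 7 :=
  jetColength_le_of_colengthCertB (B := BC) (cert := SC) (by decide +kernel)

/-- `7 ≤ μ⁺(C)`. [folklore] -/
theorem le_jetColength_child : 7 ≤ RidgeBudget.jetColength 3 5 sC.toState.F :=
  length_le_jetColength_of_dualCertB (D := DC) (by decide +kernel)

/-- **`μ⁺(P) = 6`** ‖ K. [OURS · ‖ K] [folklore] -/
theorem jetColength_parent : RidgeBudget.jetColength 3 3 sP.toState.F = 6 :=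
  le_antisymm jetColength_parent_le le_jetColength_parent

/-- **`μ⁺(C) = 7`** ‖ K. [OURS · ‖ K] [folklore] -/
theorem jetColength_child : RidgeBudget.jetColength 3 5 sC.toState.F = 7 :=
  le_antisymm jetColength_child_le le_jetColength_child

/-! ## §2 The parent is a WIDE floor state: `ord₀ P = 3`, `ē(P) = 2` -/

/-- `ord₀ P = 3`. [folklore] -/
theorem ordZero_parent : ordZero sP.toState.F = 3 := by
  rw [SData.toState_F, ordZero_evalT]; decide

/-- `P` is clean. [folklore] -/
theorem isClean_parent : HauserPerlega.IsClean 3 sP.toState.F := by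
  rw [SData.toState_F]
  exact WideNonDrop.isClean_evalT_of_live (by decide)

/-- **Coefficients from a Boolean predicate on exponents**: if no exponent of the term list satisfies `Pred`,
every `d` with `Pred d` has coefficient `0`. [folklore] -/
theorem coeff_evalT_eq_zero_of_all {L : Terms 4 (ZMod 3)} (Pred : (Fin 4 → ℕ) → Bool)
    (h : L.all (fun t => !Pred t.1) = true) {d : Fin 4 →₀ ℕ} (hd : Pred ⇑d = true) :
    coeff d (evalT L) = 0 := by
  rw [coeff_evalT]
  refine coeffAt_eq_zero_of_forall_ne fun t ht hte => ?_
  simp only [List.all_eq_true, Bool.not_eq_true'] at h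
  have h' := h t ht
  rw [hte, hd] at h'
  exact Bool.noConfusion h'

/-- The degree-`3` part of `P` is `2xy²`: degree-`3` exponents involving `u` or `v` have coefficient `0`.
[folklore] -/
theorem coeff_parent_eq_zero {d : Fin 4 →₀ ℕ} (hd : d.degree = 3) (huv : 0 < d 2 ∨ 0 < d 3) :
    coeff d sP.toState.F = 0 := by
  rw [SData.toState_F]
  refine coeff_evalT_eq_zero_of_all (fun e => decide (∑ i, e i = 3 ∧ (0 < e 2 ∨ 0 < e 3))) (by decide) ?_
  rw [decide_eq_true_iff, ← ColengthCert.degree_eq_sum_coe]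
  exact ⟨hd, huv⟩

/-- `e_u, e_v ∈ A(in P)`. [folklore] -/
theorem single_mem_additiveSubspace_parent {k : Fin 4} (hk : k = 2 ∨ k = 3) :
    (Pi.single k 1 : Fin 4 → ZMod 3) ∈ additiveSubspace (initialForm sP.toState.F) := by
  rw [NarrowApolarity.mem_additiveSubspace_iff_forall (q := 3) ordZero_parent]
  intro β hβ
  refine Finset.sum_eq_zero fun i _ => ?_
  by_cases hik : i = k
  · subst hik
    rw [coeff_parent_eq_zero (by rw [NarrowApolarity.degree_add_single]; omega) ?_, zero_mul,
      mul_zero]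
    rcases hk with rfl | rfl
    · left; simp
    · right; simp
  · rw [Pi.single_eq_of_ne hik, zero_mul]

/-- **`ē(P) = 2`**. [folklore] -/
theorem ebar_parent : RidgeBudget.ebar sP.toState.F = 2 := by
  haveI : Fact (Nat.Prime 3) := ⟨Nat.prime_three⟩
  refine le_antisymm
    (Directrix.finrank_additiveSubspace_initialForm_le_two 3 ordZero_parent isClean_parent) ?_
  have hli : LinearIndependent (ZMod 3) ![(Pi.single 2 1 : Fin 4 → ZMod 3), Pi.single 3 1] := by
    rw [LinearIndependent.pair_iff]
    intro s t hst
    have h2 := congrFun hst 2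
    have h3 := congrFun hst 3
    simp at h2 h3
    exact ⟨h2, h3⟩
  have hle : Submodule.span (ZMod 3) (Set.range ![(Pi.single 2 1 : Fin 4 → ZMod 3), Pi.single 3 1]) ≤
      additiveSubspace (initialForm sP.toState.F) := by
    rw [Submodule.span_le]
    rintro _ ⟨i, rfl⟩
    fin_cases i
    · exact single_mem_additiveSubspace_parent (Or.inl rfl)
    · exact single_mem_additiveSubspace_parent (Or.inr rfl)
  have h := Submodule.finrank_mono hle
  rw [finrank_span_eq_card hli, Fintype.card_fin] at h
  exact h

/-! ## §3 `μ⁺` is not non-increasing on wide isolated edges -/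

/-- **`μ⁺` RISES on some wide isolated edge at `p = 3`**: the candidate law «`μ⁺(s⁺) ≤ μ⁺(s)` at certificate
levels along every isolated `Step0 3` edge from a floor state with `ē = 2`» is FALSE (`6 → 7` above).
[OURS · ‖ K · negative] [folklore] -/
theorem not_wideNonIncrease_three :
    ¬ (∀ (K : Type) [Field K] [CharP K 3] [DecidableEq K] (s s' : State K) (N N' : ℕ),
        IsIsolated 3 s.F → IsIsolated 3 s'.F → Step0 3 s s' → ordZero s.F = 3 →
          RidgeBudget.ebar s.F = 2 → RidgeBudget.IsCert 3 N s.F → RidgeBudget.IsCert 3 N' s'.F →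
            RidgeBudget.jetColength 3 N' s'.F ≤ RidgeBudget.jetColength 3 N s.F) := by
  intro h
  have hle := h (ZMod 3) sP.toState sC.toState 3 5 isIsolated_parent isIsolated_child step_PC
    ordZero_parent ebar_parent isCert_parent isCert_child
  rw [jetColength_parent, jetColength_child] at hle
  omega

/-- The same with the wide hypothesis in `NoWideTrap`'s form `2 ≤ ē(s)`. [OURS · ‖ K · negative] [folklore] -/
theorem not_wideNonIncrease_three' :
    ¬ (∀ (K : Type) [Field K] [CharP K 3] [DecidableEq K] (s s' : State K) (N N' : ℕ),
        IsIsolated 3 s.F → IsIsolated 3 s'.F → Step0 3 s s' → ordZero s.F = 3 →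
          2 ≤ RidgeBudget.ebar s.F → RidgeBudget.IsCert 3 N s.F → RidgeBudget.IsCert 3 N' s'.F →
            RidgeBudget.jetColength 3 N' s'.F ≤ RidgeBudget.jetColength 3 N s.F) := by
  intro h
  have hle := h (ZMod 3) sP.toState sC.toState 3 5 isIsolated_parent isIsolated_child step_PC
    ordZero_parent ebar_parent.ge isCert_parent isCert_child
  rw [jetColength_parent, jetColength_child] at hle
  omega

/-- **A wide isolated floor edge with `μ⁺` RISING exists**: `μ⁺(P) = 6 < 7 = μ⁺(C)`. [OURS · ‖ K] [folklore] -/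
theorem exists_wide_edge_jetColength_lt :
    ∃ (s s' : State (ZMod 3)), IsIsolated 3 s.F ∧ IsIsolated 3 s'.F ∧ Step0 3 s s' ∧
      ordZero s.F = 3 ∧ RidgeBudget.ebar s.F = 2 ∧ RidgeBudget.IsCert 3 3 s.F ∧
        RidgeBudget.IsCert 3 5 s'.F ∧
          RidgeBudget.jetColength 3 3 s.F = 6 ∧ RidgeBudget.jetColength 3 5 s'.F = 7 :=
  ⟨sP.toState, sC.toState, isIsolated_parent, isIsolated_child, step_PC, ordZero_parent, ebar_parent,
    isCert_parent, isCert_child, jetColength_parent, jetColength_child⟩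

end WideRise

end Summit.ResolutionOfSingularities.ResolutionOfSingularities.Theorems.PIDim4

end
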